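/-
Copyright (c) 2026 the pub-hodgecm-mathlib formalisation cell (harness21).  Prover seat hodgecm-mathlib-LH4-p08 (g2), req620 Track A «(D-RAM) FOUR-FRAME» squad, unit U3_Laws (iii),
MS ROAD STAGE B (Stage B lead LH4-p10 (g2), MS ledger LH4-p11; dealer LH4-plan (g11)): B56-ASSEMBLY `stub_B56_G1` (skeleton `B10-StableCountTypeZero.SKELETON.v1` c61f53438acbd4dd :84),
FILE F2 «THE TUBE SUMMAND and the EMPTY REGIMES off the glue foot».  2026-09-04.
-/
import Summits.HodgeConjecture.HodgeConjecture.Theorems.F0P3cDyRamDiagonalGluedBoxCount        -- ★ p856104 B5 (iv) (this seat): `ncard_dualisable_glued_eq`; brings ★ (iv-a) `exists_gl_coe_eq_glued`, ★ B5 (i), ★ B5 (iii) FILE 2 (`stabiliserWeight_latt_glued_tube_eq`, `index_product_eq_sq_mul_pow`, `ne_zero_and_v_lt_one_of_v_eq_exp`)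
import Summits.HodgeConjecture.HodgeConjecture.Theorems.F0P3cDyRamDiagonalGluedStability       -- ★ p855795 B5 (ii) (LH4-p10 (g2)): `mapGL_latt_hnf_glued_eq_iff`, `mapGL_latt_hnf_glued_eq_of_depths`, `depths_of_mapGL_latt_hnf_glued_eq`
import Summits.HodgeConjecture.HodgeConjecture.Theorems.F0P3cDyRamDiagonalStratumTools         -- ★ (LH4-p13 (g2)): `finsum_mem_eq_ncard_mul`
import HarnessLib

/-!
# Crux `H413`, MS ROAD STAGE B, B56-ASSEMBLY FILE F2: the glued stratum with foot on `B₁` — THE TUBE SUMMAND `(q − 1)·q^{2ρ + t − 1}` and the EMPTY regimes off the glue foot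

Cell `hodgecm-mathlib` (D-0151), FLOOR 0, crux item H413 = `stmt-HodgeConjecture-24833`; lane `--supports stmt-HodgeConjecture-24833 --as helper` (count-neutral).  THEOREMS ONLY (no `def`,
no instance, no notation, no `sorry`, default heartbeats).
THE OBJECT.  For `T = diag(α, β, 1)` (units, root depths `|β − 1| = |ϖ|^{n₁}`, `|α − 1| = |ϖ|^{n₂}`, `|β − α| = |ϖ|^{n₃}`) and `ρ, s ≥ 1`, the GLUED STABLE DUALISABLE FAMILY
`𝒢(ρ, s) = {latt V(x,ζ,y″) : |x| = |ζ| = 1, |y″| = |ϖ|^s, T·latt V = latt V, dualisable}`, `V(x,ζ,y″) = (1 0 0; x ϖ^ρ 0; xζ+y″ ϖ^ρζ ϖ^{2ρ+s})` — by F0P3-p01 (g31)'s ★-soon bridge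
`stratum_G1_eq` this IS `stratum σ ϖ T ![2ρ, 2ρ+s, 2ρ+s]`; the set is spelled out verbatim in every head (no `def`).
* §1 `glued_eq_of_depths` — on the TUBE (`2ρ + s ≤ n₁`, `2ρ ≤ n₂`, `ρ ≤ n₃`) the stability conjunct is automatic (★ B5 (ii) `mapGL_latt_hnf_glued_eq_of_depths`): `𝒢(ρ,s)` = the dualisable glued
  lattices counted by ★ B5 (iv).
* §2 `stabiliserWeight_of_mem_glued` — every dualisable glued lattice (`s = 2t`) has weight `1∕(((q−1)q^{⌈(ρ+2t)∕2⌉−1})((q−1)q^{ρ−1}))` (★ B5 (i) `isDualisableLattice_latt_hnf_glued_imp` feeds (R) to ★ B5 (iii)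
  `stabiliserWeight_latt_glued_tube_eq`).
* §3 HEAD **`finsum_stabiliserWeight_glued_tube_eq`** — on the tube, `s = 2t`: `∑ᶠ_{M ∈ 𝒢(ρ,2t)} w(M) = (q − 1)·q^{2ρ + t − 1}` (★ B5 (iv) count × §2 weight; the first summand of `stub_B56_G1`).
* §4 `glued_eq_empty_of_offFoot` (`n₁ ≠ n₂ + s` and not on the tube ⇒ `𝒢 = ∅`, ★ B5 (ii) `depths_of_mapGL_latt_hnf_glued_eq`), `glued_eq_empty_of_depth_lt` (`n₃ < ρ ⇒ 𝒢 = ∅`, first stability congruence).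
HONEST LABEL.  Count-neutral; nothing printed is asserted; the census laws stay PROVER TARGETS; `HC_CM` is proved only modulo the 7 printed citations (2 remaining named inputs: hLiu418 =
`stmt-HodgeConjecture-24832`, h413 = `stmt-HodgeConjecture-24833`) until rung 0 closes.

## References
* [Kottwitz1986BaseChangeUnits] R. Kottwitz, *Base change for unit elements of Hecke algebras*, Compositio Math. 60 (1986), §1 pp. 240–241 (counting fixed lattices by torus orbits and stabilisers).
* [Rogawski1990] J. D. Rogawski, *Automorphic Representations of Unitary Groups in Three Variables*, Ann. of Math. Stud. 123 (1990), §4.9 Prop. 4.9.1 (a) p. 55.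
-/

set_option autoImplicit false

noncomputable section

namespace Summit.HodgeConjecture.HodgeConjecture.Cruxes.H413.F0P3cDyRamDiagonalGluedTubeContribution

open Matrix
open Literature.NumberTheory.Automorphic Literature.NumberTheory.Automorphic.HermitianLattice
open Literature.NumberTheory.Automorphic.UnitaryLatticeTree
open Summit.HodgeConjecture.HodgeConjecture.Cruxes.H413.F0P3cDyRamDiagonalTorusDefs
open Summit.HodgeConjecture.HodgeConjecture.Cruxes.H413.F0P3cDyRamDiagonalGluedTorusOrbits (exists_gl_coe_eq_glued)
open Summit.HodgeConjecture.HodgeConjecture.Cruxes.H413.F0P3cDyRamDiagonalGluedTubeCriterion (isDualisableLattice_latt_hnf_glued_imp)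
open Summit.HodgeConjecture.HodgeConjecture.Cruxes.H413.F0P3cDyRamDiagonalGluedStabiliserIndex (stabiliserWeight_latt_glued_tube_eq index_product_eq_sq_mul_pow
  ne_zero_and_v_lt_one_of_v_eq_exp)
open Summit.HodgeConjecture.HodgeConjecture.Cruxes.H413.F0P3cDyRamDiagonalGluedStability
open Summit.HodgeConjecture.HodgeConjecture.Cruxes.H413.F0P3cDyRamDiagonalGluedBoxCount (ncard_dualisable_glued_eq)
open Summit.HodgeConjecture.HodgeConjecture.Cruxes.H413.F0P3cDyRamDiagonalStratumTools (finsum_mem_eq_ncard_mul)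
open scoped Valued WithZero Matrix MatrixGroups

variable {K : Type*} [Field K] [Valued K ℤᵐ⁰]

/-! ## §1 On the tube the stability conjunct is automatic -/

/-- **ON THE TUBE** (`2ρ + s ≤ n₁`, `2ρ ≤ n₂`, `ρ ≤ n₃`) every glued lattice is `T`-stable (★ B5 (ii)), so the glued stable dualisable family is the dualisable glued family of ★ B5 (iv).
[cite: Kottwitz1986BaseChangeUnits, §1 pp. 240–241] -/
theorem glued_eq_of_depths (σ : K →+* K) {ϖ : K} (hϖ0 : ϖ ≠ 0) (hϖ1 : Valued.v ϖ ≤ 1) {α β : K} (hα : Valued.v α = 1) (hβ : Valued.v β = 1)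
    (T : GL (Fin 3) K) (hT : (T : Matrix (Fin 3) (Fin 3) K) = Matrix.diagonal ![α, β, 1]) {n₁ n₂ n₃ : ℕ}
    (h₁ : Valued.v (β - 1) = Valued.v ϖ ^ n₁) (h₂ : Valued.v (α - 1) = Valued.v ϖ ^ n₂) (h₃ : Valued.v (β - α) = Valued.v ϖ ^ n₃)
    (ρ s : ℕ) (hρ₁ : 2 * ρ + s ≤ n₁) (hρ₂ : 2 * ρ ≤ n₂) (hρ₃ : ρ ≤ n₃) :
    {M : Submodule 𝒪[K] (Fin 3 → K) | ∃ x ζ y'' : K, Valued.v x = 1 ∧ Valued.v ζ = 1 ∧ Valued.v y'' = Valued.v ϖ ^ s ∧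
        M = latt (!![1, 0, 0; x, ϖ ^ ρ, 0; x * ζ + y'', ϖ ^ ρ * ζ, ϖ ^ (2 * ρ + s)] : Matrix (Fin 3) (Fin 3) K) ∧ mapGL T M = M ∧ IsDualisableLattice σ ϖ M} =
      {M | ∃ x ζ y'' : K, Valued.v x = 1 ∧ Valued.v ζ = 1 ∧ Valued.v y'' = Valued.v ϖ ^ s ∧
        M = latt (!![1, 0, 0; x, ϖ ^ ρ, 0; x * ζ + y'', ϖ ^ ρ * ζ, ϖ ^ (2 * ρ + s)] : Matrix (Fin 3) (Fin 3) K) ∧ IsDualisableLattice σ ϖ M} := by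
  ext M
  constructor
  · rintro ⟨x, ζ, y'', hx, hζ, hy'', hM, -, hdual⟩
    exact ⟨x, ζ, y'', hx, hζ, hy'', hM, hdual⟩
  · rintro ⟨x, ζ, y'', hx, hζ, hy'', hM, hdual⟩
    obtain ⟨V, hV⟩ := exists_gl_coe_eq_glued x ζ y'' (pow_ne_zero ρ hϖ0) (pow_ne_zero (2 * ρ + s) hϖ0)
    refine ⟨x, ζ, y'', hx, hζ, hy'', hM, ?_, hdual⟩
    rw [hM, ← hV]
    exact mapGL_latt_hnf_glued_eq_of_depths hϖ0 hϖ1 hα hβ T hT h₁ h₂ h₃ ρ s hρ₁ hρ₂ hρ₃ hx hζ hy'' V hV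

/-! ## §2 The weight of a dualisable glued lattice -/

/-- **THE WEIGHT IS CONSTANT ON THE DUALISABLE GLUED FAMILY** (`s = 2t`): `w(M) = 1∕(((q−1)q^{⌈(ρ+2t)∕2⌉−1})·((q−1)q^{ρ−1}))` — dualisability supplies the fixed `f` of (R) (★ B5 (i)), and
★ B5 (iii) computes `[𝒰 : S_F(M)]`. [cite: Kottwitz1986BaseChangeUnits, §1 pp. 240–241] [cite: Rogawski1990, §4.9 Prop. 4.9.1 (a) p. 55] -/
theorem stabiliserWeight_of_mem_glued {σ : K →+* K} (hσ : ∀ a, σ (σ a) = a) (hvσ : ∀ a, Valued.v (σ a) = Valued.v a)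
    (hfix : ∀ x : K, σ x = x → x ≠ 0 → ∃ n : ℤ, Valued.v x = WithZero.exp (2 * n)) {ϖ : K} (hϖ : Valued.v ϖ = WithZero.exp (-1 : ℤ))
    {d : ℕ} (hd : Valued.v (ϖ - σ ϖ) = Valued.v ϖ ^ d) [Finite 𝓀[K]] {ρ : ℕ} (hρ : 1 ≤ ρ) (t : ℕ) {M : Submodule 𝒪[K] (Fin 3 → K)}
    (hM : M ∈ {M : Submodule 𝒪[K] (Fin 3 → K) | ∃ x ζ y'' : K, Valued.v x = 1 ∧ Valued.v ζ = 1 ∧ Valued.v y'' = Valued.v ϖ ^ (2 * t) ∧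
        M = latt (!![1, 0, 0; x, ϖ ^ ρ, 0; x * ζ + y'', ϖ ^ ρ * ζ, ϖ ^ (2 * ρ + 2 * t)] : Matrix (Fin 3) (Fin 3) K) ∧ IsDualisableLattice σ ϖ M}) :
    stabiliserWeight σ M =
      ((((Nat.card 𝓀[K] - 1) * Nat.card 𝓀[K] ^ ((ρ + 2 * t + 1) / 2 - 1)) * ((Nat.card 𝓀[K] - 1) * Nat.card 𝓀[K] ^ (ρ - 1)) : ℕ) : ℚ)⁻¹ := by
  obtain ⟨x, ζ, y'', hx, hζ, hy'', rfl, hdual⟩ := hM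
  obtain ⟨hϖ0, hϖ1⟩ := ne_zero_and_v_lt_one_of_v_eq_exp hϖ
  obtain ⟨V, hV⟩ := exists_gl_coe_eq_glued x ζ y'' (pow_ne_zero ρ hϖ0) (pow_ne_zero (2 * ρ + 2 * t) hϖ0)
  rw [← hV] at hdual ⊢
  obtain ⟨f, hf, hR⟩ := isDualisableLattice_latt_hnf_glued_imp hσ hvσ hϖ0 hϖ1.le ρ t hx hζ.le
    (by rw [hy'']; exact pow_le_one₀ zero_le hϖ1.le) V hV hdual
  exact stabiliserWeight_latt_glued_tube_eq hσ hvσ hfix hϖ hd hρ t hx hζ hy'' V hV hf hR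

/-! ## §3 HEAD — the tube summand -/

/-- **THE TUBE SUMMAND of `stub_B56_G1`**: on the tube (`2ρ + 2t ≤ n₁`, `2ρ ≤ n₂`, `ρ ≤ n₃`; `ρ, t ≥ 1`; wild trace bound `|a + σa| ≤ |ϖ|·|a|`)
`∑ᶠ_{M ∈ 𝒢(ρ, 2t)} 1∕[𝒰 : S_F(M)] = (q − 1)·q^{2ρ + t − 1}` — ★ B5 (iv)'s `(q−1)³q^{3ρ+⌈ρ∕2⌉+2t−3}` lattices times the §2 weight. [cite: Kottwitz1986BaseChangeUnits, §1 pp. 240–241]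
[cite: Rogawski1990, §4.9 Prop. 4.9.1 (a) p. 55] -/
theorem finsum_stabiliserWeight_glued_tube_eq {σ : K →+* K} (hσ : ∀ a, σ (σ a) = a) (hvσ : ∀ a, Valued.v (σ a) = Valued.v a)
    (hfix : ∀ x : K, σ x = x → x ≠ 0 → ∃ n : ℤ, Valued.v x = WithZero.exp (2 * n)) {ϖ : K} (hϖ : Valued.v ϖ = WithZero.exp (-1 : ℤ))
    {d : ℕ} (hd : Valued.v (ϖ - σ ϖ) = Valued.v ϖ ^ d) [Finite 𝓀[K]] (hTr : ∀ a : K, Valued.v (a + σ a) ≤ Valued.v ϖ * Valued.v a)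
    {α β : K} (hα : Valued.v α = 1) (hβ : Valued.v β = 1) (T : GL (Fin 3) K) (hT : (T : Matrix (Fin 3) (Fin 3) K) = Matrix.diagonal ![α, β, 1])
    {n₁ n₂ n₃ : ℕ} (h₁ : Valued.v (β - 1) = Valued.v ϖ ^ n₁) (h₂ : Valued.v (α - 1) = Valued.v ϖ ^ n₂) (h₃ : Valued.v (β - α) = Valued.v ϖ ^ n₃)
    (ρ t : ℕ) (hρ : 1 ≤ ρ) (ht : 1 ≤ t) (hρ₁ : 2 * ρ + 2 * t ≤ n₁) (hρ₂ : 2 * ρ ≤ n₂) (hρ₃ : ρ ≤ n₃) :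
    ∑ᶠ M ∈ {M : Submodule 𝒪[K] (Fin 3 → K) | ∃ x ζ y'' : K, Valued.v x = 1 ∧ Valued.v ζ = 1 ∧ Valued.v y'' = Valued.v ϖ ^ (2 * t) ∧
        M = latt (!![1, 0, 0; x, ϖ ^ ρ, 0; x * ζ + y'', ϖ ^ ρ * ζ, ϖ ^ (2 * ρ + 2 * t)] : Matrix (Fin 3) (Fin 3) K) ∧ mapGL T M = M ∧ IsDualisableLattice σ ϖ M},
        stabiliserWeight σ M = ((Nat.card 𝓀[K] : ℚ) - 1) * (Nat.card 𝓀[K] : ℚ) ^ (2 * ρ + t - 1) := by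
  obtain ⟨hϖ0, hϖ1⟩ := ne_zero_and_v_lt_one_of_v_eq_exp hϖ
  have hq : 1 < Nat.card 𝓀[K] := Finite.one_lt_card
  have hcount := ncard_dualisable_glued_eq hσ hvσ hfix hϖ hd hTr ρ t hρ ht
  have hne : (Nat.card 𝓀[K] - 1) ^ 3 * Nat.card 𝓀[K] ^ (3 * ρ + (ρ + 1) / 2 + 2 * t - 3) ≠ 0 :=
    mul_ne_zero (pow_ne_zero _ (by omega)) (pow_ne_zero _ (by omega))
  have hfin := Set.finite_of_ncard_ne_zero (hcount ▸ hne)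
  rw [glued_eq_of_depths σ hϖ0 hϖ1.le hα hβ T hT h₁ h₂ h₃ ρ (2 * t) hρ₁ hρ₂ hρ₃,
    finsum_mem_eq_ncard_mul hfin _ _ (fun M hM => stabiliserWeight_of_mem_glued hσ hvσ hfix hϖ hd hρ t hM), hcount,
    index_product_eq_sq_mul_pow (Nat.card 𝓀[K]) hρ (2 * t)]
  have hA : 3 * ρ + (ρ + 1) / 2 + 2 * t - 3 = (2 * ρ + t - 1) + ((ρ + 2 * t + 1) / 2 + ρ - 2) := by omega
  rw [hA, pow_add]
  have hq1 : ((Nat.card 𝓀[K] : ℚ) - 1) ≠ 0 := sub_ne_zero.2 (by exact_mod_cast hq.ne')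
  have hq0 : (Nat.card 𝓀[K] : ℚ) ≠ 0 := by exact_mod_cast (by omega : Nat.card 𝓀[K] ≠ 0)
  push_cast [Nat.cast_sub hq.le]
  field_simp

/-! ## §4 The empty regimes off the glue foot -/

/-- **OFF THE FOOT AND BELOW THE TUBE THERE IS NOTHING**: if `n₁ ≠ n₂ + s` then a `T`-stable glued lattice forces `2ρ + s ≤ n₁ ∧ 2ρ ≤ n₂` (★ B5 (ii) `depths_of_mapGL_latt_hnf_glued_eq`), so
below the tube the glued stable dualisable family is empty. [cite: Kottwitz1986BaseChangeUnits, §1 pp. 240–241] -/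
theorem glued_eq_empty_of_offFoot (σ : K →+* K) {ϖ : K} (hϖ0 : ϖ ≠ 0) (hϖ1 : Valued.v ϖ < 1) {α β : K} (hα : Valued.v α = 1) (hβ : Valued.v β = 1)
    (T : GL (Fin 3) K) (hT : (T : Matrix (Fin 3) (Fin 3) K) = Matrix.diagonal ![α, β, 1]) {n₁ n₂ : ℕ}
    (h₁ : Valued.v (β - 1) = Valued.v ϖ ^ n₁) (h₂ : Valued.v (α - 1) = Valued.v ϖ ^ n₂) (ρ s : ℕ) (hne : n₁ ≠ n₂ + s)
    (hlow : ¬ (2 * ρ + s ≤ n₁ ∧ 2 * ρ ≤ n₂)) :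
    {M : Submodule 𝒪[K] (Fin 3 → K) | ∃ x ζ y'' : K, Valued.v x = 1 ∧ Valued.v ζ = 1 ∧ Valued.v y'' = Valued.v ϖ ^ s ∧
        M = latt (!![1, 0, 0; x, ϖ ^ ρ, 0; x * ζ + y'', ϖ ^ ρ * ζ, ϖ ^ (2 * ρ + s)] : Matrix (Fin 3) (Fin 3) K) ∧ mapGL T M = M ∧ IsDualisableLattice σ ϖ M} = ∅ := by
  ext M
  simp only [Set.mem_setOf_eq, Set.mem_empty_iff_false, iff_false]
  rintro ⟨x, ζ, y'', hx, hζ, hy'', rfl, hstab, -⟩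
  obtain ⟨V, hV⟩ := exists_gl_coe_eq_glued x ζ y'' (pow_ne_zero ρ hϖ0) (pow_ne_zero (2 * ρ + s) hϖ0)
  rw [← hV] at hstab
  exact hlow (depths_of_mapGL_latt_hnf_glued_eq hϖ0 hϖ1 hα hβ T hT h₁ h₂ ρ s hne hx hζ hy'' V hV hstab)

/-- **TOO SHALLOW A ROOT**: if `n₃ < ρ` no glued lattice is `T`-stable (the first stability congruence `|(β − α)x| ≤ |ϖ|^ρ` of ★ B5 (ii) fails), so the family is empty.
[cite: Kottwitz1986BaseChangeUnits, §1 pp. 240–241] -/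
theorem glued_eq_empty_of_depth_lt (σ : K →+* K) {ϖ : K} (hϖ : Valued.v ϖ = WithZero.exp (-1 : ℤ)) {α β : K} (hα : Valued.v α = 1) (hβ : Valued.v β = 1)
    (T : GL (Fin 3) K) (hT : (T : Matrix (Fin 3) (Fin 3) K) = Matrix.diagonal ![α, β, 1]) {n₃ : ℕ} (h₃ : Valued.v (β - α) = Valued.v ϖ ^ n₃)
    (ρ s : ℕ) (hlt : n₃ < ρ) :
    {M : Submodule 𝒪[K] (Fin 3 → K) | ∃ x ζ y'' : K, Valued.v x = 1 ∧ Valued.v ζ = 1 ∧ Valued.v y'' = Valued.v ϖ ^ s ∧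
        M = latt (!![1, 0, 0; x, ϖ ^ ρ, 0; x * ζ + y'', ϖ ^ ρ * ζ, ϖ ^ (2 * ρ + s)] : Matrix (Fin 3) (Fin 3) K) ∧ mapGL T M = M ∧ IsDualisableLattice σ ϖ M} = ∅ := by
  obtain ⟨hϖ0, -⟩ := ne_zero_and_v_lt_one_of_v_eq_exp hϖ
  ext M
  simp only [Set.mem_setOf_eq, Set.mem_empty_iff_false, iff_false]
  rintro ⟨x, ζ, y'', hx, hζ, hy'', rfl, hstab, -⟩
  obtain ⟨V, hV⟩ := exists_gl_coe_eq_glued x ζ y'' (pow_ne_zero ρ hϖ0) (pow_ne_zero (2 * ρ + s) hϖ0)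
  rw [← hV] at hstab
  have h := ((mapGL_latt_hnf_glued_eq_iff hϖ0 hα hβ T hT ρ s x ζ y'' V hV).1 hstab).1
  rw [map_mul, hx, mul_one, h₃, UnitaryLatticeTree.v_pow_le_v_pow_iff hϖ] at h
  omega

end Summit.HodgeConjecture.HodgeConjecture.Cruxes.H413.F0P3cDyRamDiagonalGluedTubeContribution

end
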